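import Mathlib
import Summits.NavierStokesRegularity.NavierStokesRegularity.Theorems.EulerZoomLiouvillePowerGaugeEulerLiouvilleNeedleAxisymThinTube

/-!
# Needle portrait, axisymmetric case: THIN FAST EXITS — the hypothesis `hthin` of the race
# (ROUND-37 plate t38j, part C)

Seat nsreg-p2 (`HOME/ns-regularity-ideate-p2/ROUND-37.md` §1 (K), v1.3); helper material for crux E
(`EulerZoomLiouville.PowerGaugeEulerLiouville`, stmt-NavierStokesRegularity-19832); nothing is wired into the
LEAD's skeleton.  The asymptotic half of Lemma K: for an axisymmetric `C¹` field `U` whose energy and Dirichlet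
budgets on balls grow at most polynomially (`≤ c_A L^{1−2ρ}`, `≤ c_E L^{1−ρ}`, `ρ ≥ 0`, `L ≥ 1` — the class (3.x)
budgets at profile level; only POLYNOMIAL growth is used), the `γ`-fast points at dyadic scale `R` live, over a
set `G` of squares of good radii of measure `≥ R²`, in an axial tube `N` with
`volume N · ∫⁻_N ofReal ‖U‖² ≤ R^{−m}` for every `m`, `R ≥ R₀(m)`:

* `thinFastExits` — literally the hypothesis `hthin` (with `κ = 1`) of
  `…NeedleRace.curl_eq_zero_of_thinFastExits` (ns-ezl-w2, ROUND-37 (R), landed);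
* the composition with that theorem (`curl_eq_zero_of_axisym_budgets`: such a profile with polynomial
  enstrophy growth is IRROTATIONAL — ROUND-37's (S37) at profile level) is the short part D
  (`…NeedleAxisymIrrotational.lean`, imports this file + `…NeedleRace`).

Proof: part B `thinFastExits_structural` with `b_A = c_A(2R)^{1−2ρ}/(2π) ≤ (c_A/π)R`, `b_E ≤ (c_E/π)R`,
`α = 4(b_A+1)/R`, `β = 4(b_E+1)/R`, `μ = 16(b_A+1)/(γ²R⁵)`, `Λ = γ²R²/(4π(β + α/R²)) ≥ λ₀R²`,
`λ₀ = γ²/(16π(a+e))`, `a = c_A/π + 1`, `e = c_E/π + 1`; the size is `≤ (4096π²a²/γ²)·e^{−2λ₀R} ≤ R^{−m}`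
eventually (`tendsto_rpow_mul_exp_neg_mul_atTop_nhds_zero`).
Namespace `…PowerGaugeEulerLiouville.NeedleAxisymBand`, new names only.
-/

open MeasureTheory Set Real Filter Topology
open scoped ENNReal
open Literature.Analysis Literature.Analysis.FluidPDE
open Summit.NavierStokesRegularity.NavierStokesRegularity.Theorems.PowerGaugeEulerLiouville.NeedleSphericalTonelli

set_option linter.dupNamespace false

namespace Summit.NavierStokesRegularity.NavierStokesRegularity.Theorems.PowerGaugeEulerLiouville.NeedleAxisymBand

/-- Super-polynomial decay: `K e^{−bR} < R^{−m}` for `R ≥ R₂(m)`. -/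
theorem exists_exp_lt_rpow_neg {K b : ℝ} (hK : 0 < K) (hb : 0 < b) (m : ℝ) :
    ∃ R₂ : ℝ, ∀ R : ℝ, R₂ ≤ R → 0 < R → K * Real.exp (-b * R) < R ^ (-m) := by
  have ht := tendsto_rpow_mul_exp_neg_mul_atTop_nhds_zero m b hb
  have hev : ∀ᶠ R : ℝ in atTop, R ^ m * Real.exp (-b * R) < 1 / K :=
    (tendsto_order.1 ht).2 _ (by positivity)
  obtain ⟨R₂, hR₂⟩ := Filter.eventually_atTop.1 hev
  refine ⟨R₂, fun R hR hR0 => ?_⟩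
  have hf := hR₂ R hR
  have hRm : 0 < R ^ m := Real.rpow_pos_of_pos hR0 m
  rw [Real.rpow_neg hR0.le, ← one_div, lt_div_iff₀ hRm]
  have h1 : K * (R ^ m * Real.exp (-b * R)) < 1 := by
    have := (lt_div_iff₀' hK).1 hf
    linarith
  calc K * Real.exp (-b * R) * R ^ m = K * (R ^ m * Real.exp (-b * R)) := by ring
    _ < 1 := h1

/-- A polynomial budget `c L^{e}` with `e ≤ 1`, `c ≥ 0`, at `L = 2R ≥ 1`, in the form `2π·b` with `b ≤ (c/π)R`. -/
theorem budget_div_two_pi_le {c e R : ℝ} (hc : 0 ≤ c) (he : e ≤ 1) (hR : 1 ≤ 2 * R) :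
    c * (2 * R) ^ e / (2 * π) ≤ c / π * R := by
  have h1 : (2 * R) ^ e ≤ 2 * R := by
    have := Real.rpow_le_rpow_of_exponent_le hR he
    rwa [Real.rpow_one] at this
  have h2 : c * (2 * R) ^ e ≤ c * (2 * R) := mul_le_mul_of_nonneg_left h1 hc
  rw [div_le_iff₀ (by positivity)]
  have : c / π * R * (2 * π) = c * (2 * R) := by field_simp
  linarith

/-! ### Parameter algebra (pure real inequalities) -/

/-- `μ = 16(b_A+1)/(γ²R⁵) ≤ 2/5` once `R ≥ 40a/γ²`, `R ≥ 1`, `b_A + 1 ≤ aR`. -/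
theorem needleMu_le {γ R a bA : ℝ} (hγ : 0 < γ) (hR1 : 1 ≤ R) (hbA1 : bA + 1 ≤ a * R)
    (h40 : 40 * a / γ ^ 2 ≤ R) : 16 * (bA + 1) / (γ ^ 2 * R ^ 5) ≤ 2 / 5 := by
  have hR : 0 < R := by linarith
  have h40' : 40 * a ≤ R * γ ^ 2 := (div_le_iff₀ (by positivity)).1 h40
  rw [div_le_iff₀ (by positivity)]
  have h1 : 16 * (bA + 1) ≤ 16 * a * R := by nlinarith
  have h2 : 16 * a * R ≤ 2 / 5 * (R * γ ^ 2) * R :=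
    mul_le_mul_of_nonneg_right (by linarith) hR.le
  have h3 : 2 / 5 * (R * γ ^ 2) * R ≤ 2 / 5 * (R * γ ^ 2) * R * R ^ 3 :=
    le_mul_of_one_le_right (by positivity) (one_le_pow₀ hR1)
  calc 16 * (bA + 1) ≤ 2 / 5 * (R * γ ^ 2) * R * R ^ 3 := h1.trans (h2.trans h3)
    _ = 2 / 5 * (γ ^ 2 * R ^ 5) := by ring

/-- `4α = μγ²R⁴` for `α = 4(b_A+1)/R`, `μ = 16(b_A+1)/(γ²R⁵)`. -/
theorem needleMu_alpha {γ R bA : ℝ} (hγ : 0 < γ) (hR : 0 < R) :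
    4 * (4 * (bA + 1) / R) = 16 * (bA + 1) / (γ ^ 2 * R ^ 5) * (γ ^ 2 * R ^ 4) := by
  field_simp
  ring

/-- `Λ = γ²R²/(4π(β + α/R²)) ≥ λ₀R²`, `λ₀ = γ²/(16π(a+e))`, when `α ≤ 4a`, `β ≤ 4e`, `R ≥ 1`. -/
theorem needleLambda_ge {γ R a e α β : ℝ} (hR1 : 1 ≤ R) (hα : 0 < α) (hβ : 0 < β) (hαa : α ≤ 4 * a)
    (hβe : β ≤ 4 * e) :
    γ ^ 2 / (16 * π * (a + e)) * R ^ 2 ≤ γ ^ 2 * R ^ 2 / (4 * π * (β + α / R ^ 2)) := by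
  have hαR : α / R ^ 2 ≤ 4 * a := (div_le_self hα.le (one_le_pow₀ hR1)).trans hαa
  rw [div_mul_eq_mul_div]
  refine div_le_div_of_nonneg_left (by positivity) (by positivity) ?_
  calc 4 * π * (β + α / R ^ 2) ≤ 4 * π * (4 * e + 4 * a) :=
        mul_le_mul_of_nonneg_left (add_le_add hβe hαR) (by positivity)
    _ = 16 * π * (a + e) := by ring

/-- The coefficient of the tube size: `256π²R³μ b_A ≤ 4096π²a²/γ²`. -/
theorem needleCoef_le {γ R a bA : ℝ} (hγ : 0 < γ) (hR : 0 < R) (hbA0 : 0 ≤ bA) (hbA1 : bA + 1 ≤ a * R) :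
    256 * π ^ 2 * R ^ 3 * (16 * (bA + 1) / (γ ^ 2 * R ^ 5)) * bA ≤ 4096 * π ^ 2 * a ^ 2 / γ ^ 2 := by
  have h1 : 256 * π ^ 2 * R ^ 3 * (16 * (bA + 1) / (γ ^ 2 * R ^ 5)) * bA =
      4096 * π ^ 2 * (bA * (bA + 1)) / (γ ^ 2 * R ^ 2) := by
    field_simp
    ring
  have h2 : bA * (bA + 1) ≤ a ^ 2 * R ^ 2 := by
    have hb : bA ≤ a * R := by linarith
    calc bA * (bA + 1) ≤ (a * R) * (a * R) := mul_le_mul hb hbA1 (by positivity) (hbA0.trans hb)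
      _ = a ^ 2 * R ^ 2 := by ring
  rw [h1, div_le_div_iff₀ (by positivity) (by positivity)]
  calc 4096 * π ^ 2 * (bA * (bA + 1)) * γ ^ 2 ≤ 4096 * π ^ 2 * (a ^ 2 * R ^ 2) * γ ^ 2 :=
        mul_le_mul_of_nonneg_right (mul_le_mul_of_nonneg_left h2 (by positivity)) (sq_nonneg γ)
    _ = 4096 * π ^ 2 * a ^ 2 * (γ ^ 2 * R ^ 2) := by ring

/-- The tube size in closed form: `8(2R)(2R√(2πμ)e^{−Λ})²(2πb_A) = 256π²R³μ b_A e^{−2Λ}`. -/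
theorem needleSize_eq {R μ Λ bA : ℝ} (hμ : 0 ≤ μ) :
    8 * (2 * R) * (2 * R * (Real.sqrt (2 * π * μ) * Real.exp (-Λ))) ^ 2 * (2 * π * bA) =
      256 * π ^ 2 * R ^ 3 * μ * bA * Real.exp (-2 * Λ) := by
  have hs2 : (Real.sqrt (2 * π * μ) * Real.exp (-Λ)) ^ 2 = 2 * π * μ * Real.exp (-2 * Λ) := by
    rw [mul_pow, Real.sq_sqrt (by positivity), show (-2 * Λ) = -Λ + -Λ by ring, Real.exp_add, pow_two]
  rw [show (2 * R * (Real.sqrt (2 * π * μ) * Real.exp (-Λ))) ^ 2 =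
    4 * R ^ 2 * (Real.sqrt (2 * π * μ) * Real.exp (-Λ)) ^ 2 by ring, hs2]
  ring

set_option maxHeartbeats 800000 in
/-- **Thin fast exits** — the hypothesis `hthin` (κ = 1) of `…NeedleRace.curl_eq_zero_of_thinFastExits` for an
axisymmetric `C¹` field with polynomially bounded energy / Dirichlet budgets on balls. -/
theorem thinFastExits {U : (EuclideanSpace ℝ (Fin 3)) → (EuclideanSpace ℝ (Fin 3))} (hU : ContDiff ℝ 1 U) (hax : IsAxisymmetric U) {γ ρ cA cE : ℝ}
    (hγ : 0 < γ) (hρ : 0 ≤ ρ) (hcA : 0 ≤ cA) (hcE : 0 ≤ cE)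
    (hbA : ∀ L : ℝ, 1 ≤ L →
      ∫⁻ z in Metric.closedBall (0 : (EuclideanSpace ℝ (Fin 3))) L, (‖U z‖ₑ : ℝ≥0∞) ^ 2 ≤ ENNReal.ofReal (cA * L ^ (1 - 2 * ρ)))
    (hbE : ∀ L : ℝ, 1 ≤ L →
      ∫⁻ z in Metric.closedBall (0 : (EuclideanSpace ℝ (Fin 3))) L, (‖fderiv ℝ U z‖ₑ : ℝ≥0∞) ^ 2 ≤ ENNReal.ofReal (cE * L ^ (1 - ρ)))
    (m : ℝ) :
    ∃ R₀ : ℝ, ∀ R : ℝ, R₀ ≤ R → ∃ (G : Set ℝ) (N : Set (EuclideanSpace ℝ (Fin 3))), MeasurableSet G ∧ G ⊆ Icc (R ^ 2) ((2 * R) ^ 2) ∧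
      1 * R ^ 2 ≤ (volume G).toReal ∧ MeasurableSet N ∧ N ⊆ Metric.closedBall 0 (2 * R) ∧
      (∀ z, ‖z‖ ^ 2 ∈ G → inner ℝ (U z) z + γ * ‖z‖ ^ 2 < 0 → z ∈ N) ∧
      volume N * ∫⁻ z in N, ENNReal.ofReal (‖U z‖ ^ 2) ≤ ENNReal.ofReal (R ^ (-m)) := by
  -- constants
  obtain ⟨a, ha⟩ : ∃ a : ℝ, a = cA / π + 1 := ⟨_, rfl⟩
  obtain ⟨e, he⟩ : ∃ e : ℝ, e = cE / π + 1 := ⟨_, rfl⟩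
  have ha0 : 0 < a := by rw [ha]; positivity
  have he0 : 0 < e := by rw [he]; positivity
  obtain ⟨lam, hlam⟩ : ∃ lam : ℝ, lam = γ ^ 2 / (16 * π * (a + e)) := ⟨_, rfl⟩
  have hlam0 : 0 < lam := by rw [hlam]; positivity
  have hK0 : 0 < 4096 * π ^ 2 * a ^ 2 / γ ^ 2 := by positivity
  obtain ⟨R₂, hR₂⟩ := exists_exp_lt_rpow_neg hK0 (by positivity : 0 < 2 * lam) m
  refine ⟨max (max 1 (40 * a / γ ^ 2)) (max (1 / lam) R₂), fun R hR => ?_⟩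
  have hR1 : 1 ≤ R := le_trans (le_max_left _ _) ((le_max_left _ _).trans hR)
  have hR40 : 40 * a / γ ^ 2 ≤ R := le_trans (le_max_right _ _) ((le_max_left _ _).trans hR)
  have hRlam : 1 / lam ≤ R := le_trans (le_max_left _ _) ((le_max_right _ _).trans hR)
  have hRR₂ : R₂ ≤ R := le_trans (le_max_right _ _) ((le_max_right _ _).trans hR)
  have hR : 0 < R := by linarith
  have h2R : 1 ≤ 2 * R := by linarith
  -- the two ball budgets at L = 2R, written as 2π·b
  obtain ⟨bA, hbAd⟩ : ∃ b : ℝ, b = cA * (2 * R) ^ (1 - 2 * ρ) / (2 * π) := ⟨_, rfl⟩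
  obtain ⟨bE, hbEd⟩ : ∃ b : ℝ, b = cE * (2 * R) ^ (1 - ρ) / (2 * π) := ⟨_, rfl⟩
  have hbA0 : 0 ≤ bA := by rw [hbAd]; positivity
  have hbE0 : 0 ≤ bE := by rw [hbEd]; positivity
  have hbAa : bA ≤ cA / π * R := by rw [hbAd]; exact budget_div_two_pi_le hcA (by linarith) h2R
  have hbEe : bE ≤ cE / π * R := by rw [hbEd]; exact budget_div_two_pi_le hcE (by linarith) h2R
  have hbA1 : bA + 1 ≤ a * R := by
    have : a * R = cA / π * R + R := by rw [ha]; ring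
    linarith
  have hbE1 : bE + 1 ≤ e * R := by
    have : e * R = cE / π * R + R := by rw [he]; ring
    linarith
  have hIA : ∫⁻ z in Metric.closedBall (0 : (EuclideanSpace ℝ (Fin 3))) (2 * R), (‖U z‖ₑ : ℝ≥0∞) ^ 2 ≤ ENNReal.ofReal (2 * π * bA) := by
    have h := hbA (2 * R) h2R
    rwa [show cA * (2 * R) ^ (1 - 2 * ρ) = 2 * π * bA by
      rw [hbAd, mul_div_cancel₀ _ (by positivity : (2 : ℝ) * π ≠ 0)]] at h
  have hIE : ∫⁻ z in Metric.closedBall (0 : (EuclideanSpace ℝ (Fin 3))) (2 * R), (‖fderiv ℝ U z‖ₑ : ℝ≥0∞) ^ 2 ≤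
      ENNReal.ofReal (2 * π * bE) := by
    have h := hbE (2 * R) h2R
    rwa [show cE * (2 * R) ^ (1 - ρ) = 2 * π * bE by
      rw [hbEd, mul_div_cancel₀ _ (by positivity : (2 : ℝ) * π ≠ 0)]] at h
  -- thresholds and parameters
  obtain ⟨α, hαd⟩ : ∃ α : ℝ, α = 4 * (bA + 1) / R := ⟨_, rfl⟩
  obtain ⟨β, hβd⟩ : ∃ β : ℝ, β = 4 * (bE + 1) / R := ⟨_, rfl⟩
  have hα : 0 < α := by rw [hαd]; positivity
  have hβ : 0 < β := by rw [hβd]; positivity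
  have hαR : α * R = 4 * (bA + 1) := by rw [hαd, div_mul_cancel₀ _ hR.ne']
  have hβR : β * R = 4 * (bE + 1) := by rw [hβd, div_mul_cancel₀ _ hR.ne']
  have hαb : 4 * bA ≤ α * R := by rw [hαR]; linarith
  have hβb : 4 * bE ≤ β * R := by rw [hβR]; linarith
  have hαa : α ≤ 4 * a := le_of_mul_le_mul_right (by rw [hαR]; linarith) hR
  have hβe : β ≤ 4 * e := le_of_mul_le_mul_right (by rw [hβR]; linarith) hR
  obtain ⟨μ, hμd⟩ : ∃ μ : ℝ, μ = 16 * (bA + 1) / (γ ^ 2 * R ^ 5) := ⟨_, rfl⟩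
  have hμ0 : 0 ≤ μ := by rw [hμd]; positivity
  have hμα : 4 * α ≤ μ * (γ ^ 2 * R ^ 4) := by
    rw [hμd, hαd]; exact (needleMu_alpha hγ hR).le
  have hμ : μ ≤ 2 / 5 := by rw [hμd]; exact needleMu_le hγ hR1 hbA1 hR40
  have hden : 0 < 4 * π * (β + α / R ^ 2) := by positivity
  obtain ⟨Λ, hΛd⟩ : ∃ Λ : ℝ, Λ = γ ^ 2 * R ^ 2 / (4 * π * (β + α / R ^ 2)) := ⟨_, rfl⟩
  have hΛβ : 4 * π * (β + α / R ^ 2) * Λ ≤ γ ^ 2 * R ^ 2 := by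
    rw [hΛd, mul_div_cancel₀ _ hden.ne']
  have hΛlow : lam * R ^ 2 ≤ Λ := by
    rw [hΛd, hlam]; exact needleLambda_ge hR1 hα hβ hαa hβe
  have hlamR : lam * R ≤ lam * R ^ 2 := by
    have h2 : lam * R * 1 ≤ lam * R * R := mul_le_mul_of_nonneg_left hR1 (by positivity)
    have h3 : lam * R ^ 2 = lam * R * R := by ring
    linarith
  have hΛ1 : 1 ≤ Λ := by
    have h1 : 1 ≤ lam * R := by rwa [div_le_iff₀' hlam0] at hRlam
    linarith
  -- the structural theorem
  obtain ⟨G, N, h1, h2, h3, h4, h5, h6, h7⟩ :=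
    thinFastExits_structural hU hax hγ hR hα hβ hIA hIE hαb hβb hμα hμ hΛ1 hΛβ
  refine ⟨G, N, h1, h2, h3, h4, h5, h6, h7.trans (ENNReal.ofReal_le_ofReal ?_)⟩
  -- the size: 256 π² R³ μ bA e^{−2Λ} ≤ K e^{−2Λ} ≤ K e^{−2λ₀R} < R^{−m}
  have hE2 : Real.exp (-2 * Λ) ≤ Real.exp (-(2 * lam) * R) := by
    rw [Real.exp_le_exp]
    linarith
  have hcoef : 256 * π ^ 2 * R ^ 3 * μ * bA ≤ 4096 * π ^ 2 * a ^ 2 / γ ^ 2 := by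
    rw [hμd]; exact needleCoef_le hγ hR hbA0 hbA1
  rw [needleSize_eq hμ0]
  calc 256 * π ^ 2 * R ^ 3 * μ * bA * Real.exp (-2 * Λ)
      ≤ 4096 * π ^ 2 * a ^ 2 / γ ^ 2 * Real.exp (-2 * Λ) :=
        mul_le_mul_of_nonneg_right hcoef (Real.exp_pos _).le
    _ ≤ 4096 * π ^ 2 * a ^ 2 / γ ^ 2 * Real.exp (-(2 * lam) * R) := mul_le_mul_of_nonneg_left hE2 hK0.le
    _ ≤ R ^ (-m) := (hR₂ R hRR₂ hR).le

end Summit.NavierStokesRegularity.NavierStokesRegularity.Theorems.PowerGaugeEulerLiouville.NeedleAxisymBand
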